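import Literature.AlgebraicGeometry.AbelianSchemes.TupleTransportToBaseChange   -- ★ (imports the AnyBase dual-transport clauses, lamTransport, GS-1a, FibreIdentity)
import HarnessLib

/-!
# An isomorphism of group schemes over ANY reduced locally Noetherian base, exact on the action, the level sections and `λ` (dual-transport
# form), IS an isomorphism of PEL tuples along `𝟙` — «LAYER A′», the connectedness-free twin of ★ BRICK (T) §2 `isoOfTriples_id_of_iso`

Topic `AlgebraicGeometry/AbelianSchemes`; namespace `Literature.AlgebraicGeometry.AbelianSchemes.AbelianSchemeOver`.  THEOREMS ONLY (no definition,
no named fact, no instance, no notation, no `sorry`).  Cell hodgecm-mathlib (D-0151), P6 «MOD programme» (crux hLiu418 = stmt-HodgeConjecture-24832,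
`--supports`, count-neutral); L4 `stub_GSPREAD` chain step (5) (B-p18 (g39) census `CENSUS-stubGSPREAD-chain.v1` c894dffb; LA4-plan DEAL v1).  ★ BRICK (T)
§2 `isoOfTriples_id_of_iso` needs `[PreconnectedSpace T]` (its dual clause goes through ★ `hat_isBaseChangeVia_id_hatTransport_of_isLocallyNoetherian`);
the generic fibre `(S.M Kc) ⊗_F Fᵢ` of a Shimura curve need NOT be connected, so the chain uses the ANY-BASE dual clauses ★
`hat_isBaseChangeVia_id_hatTransport_of_isLocallyNoetherian_base` ∕ ★ `nonempty_pullback_map_hatTransport_iso` instead ([MumfordFogartyKirwan1994] Ch. 6 §1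
Cor. 6.4 AS PRINTED: no connectedness).  The `λ`-hypothesis is taken in the DUAL-TRANSPORT form `e ≫ λ₂ = λ₁ ≫ Ĥ_e` (★ `hatTransportOver`), which is
how ★ `Polarization.exists_lam_eq_lamTransport` delivers transported polarisations.  HC_CM is proved only modulo the printed citations until rung 0
closes; nothing here is about HC.

MAIN STATEMENTS.  §1 **`tupleRel_id_of_iso_of_hatTransportOver`** — for `e : A₁.X ≅ A₂.X` (`IsMonHom`), dual pairs with the unit hypothesis, and
structures satisfying `φ₁.σᵢ ≫ e = φ₂.σᵢ`, `e ≫ λ₂ = λ₁ ≫ Ĥ_e`, `ρ₁(a) ≫ e = e ≫ ρ₂(a)`: the six clauses along `𝟙 T` via `(e, Ĥ_e)`;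
§2 **`exists_levelStructure_polarization_tupleRel_id_of_iso`** — the same where `φ₂` and the polarisation `pol₂` of `(A₂, D₂)` are PRODUCED by
transport (★ `LevelStructure.exists_comp_of_iso`, ★ `Polarization.exists_lam_eq_lamTransport`) and only the action `ρ₂` with its equivariance is given
(the shape of a MOVE TO A FINER STAGE: `e :=` ★ `facObjIso (relLeg σ)`⁻¹, `ρ₂ :=` the base change of the spread action of ★ (s1-ι), whose `hz` is the
equivariance).

## References
* [MumfordFogartyKirwan1994] D. Mumford, J. Fogarty, F. Kirwan, *Geometric Invariant Theory*, 3rd ed. (1994), Ch. 6 §1 Cor. 6.4 (p. 117), Ch. 7 §2 Def. 7.2–7.3 (pp. 129–130).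
* [MilneAV2008] J. S. Milne, *Abelian Varieties* (2008), I §8 (pp. 36–37).
* [Kottwitz1992] R. Kottwitz, *Points on some Shimura varieties over finite fields*, JAMS 5 (1992), §5 (p. 390).
-/

set_option autoImplicit false

noncomputable section

-- Mathlib's `Over`/pull-back API is stated across semireducible wrappers (as in the ★ `AbelianSchemes/*` files).
set_option backward.isDefEq.respectTransparency false

open CategoryTheory CategoryTheory.Limits AlgebraicGeometry MonoidalCategory

namespace Literature.AlgebraicGeometry.AbelianSchemes

namespace AbelianSchemeOver

-- UNIVERSE 0: ★ `Polarization.exists_lam_eq_lamTransport` is stated for `Scheme.{0}`; the consumer is universe 0.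
variable {T : Scheme.{0}} [IsLocallyNoetherian T] [IsReduced T] {A₁ A₂ : AbelianSchemeOver T} (D₁ : A₁.DualPair) (D₂ : A₂.DualPair)
  {O : Type*} [CommRing O] (ρ₁ : RingAction O A₁) (ρ₂ : RingAction O A₂) {g n : ℕ}
  (e : A₁.X ≅ A₂.X) [IsMonHom e.hom]

/-! ### §1 Layer A′: all structures given -/

omit [IsReduced T] in
/-- **LAYER A′ — AN ISOMORPHISM EXACT ON `λ` (DUAL-TRANSPORT FORM), LEVEL AND ACTION IS AN ISOMORPHISM OF TUPLES ALONG `𝟙 T`, OVER ANY REDUCED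
LOCALLY NOETHERIAN BASE.**  For `e : A₁ ≅ A₂` a homomorphism of `T`-group schemes, dual pairs `D₁`, `D₂` with the unit hypothesis
`𝒫ᵢ|_{Aᵢ × {ε}} ≅ 𝒪` (`hD₁`, `hD₂`), morphisms `λᵢ : Aᵢ → Âᵢ`, level structures `φᵢ` and actions `ρᵢ` with (lvl) `φ₁.σᵢ ≫ e = φ₂.σᵢ`, (pol)
`e ≫ λ₂ = λ₁ ≫ Ĥ_e` (★ `hatTransportOver D₂ D₁ e : Â₁ → Â₂`), (act) `ρ₁(a) ≫ e = e ≫ ρ₂(a)`: the six clauses of [MumfordFogartyKirwan1994] Def. 7.2–7.3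
along `𝟙 T` hold from tuple 1 to tuple 2 via `(G, Ĝ) = (e, Ĥ_e)` — level ∕ `X` ★ `levelStructure_isBaseChangeVia_id_of_isMonHom`, `X̂` ★
`hat_isBaseChangeVia_id_hatTransport_of_isLocallyNoetherian_base`, Poincaré ★ `nonempty_pullback_map_hatTransport_iso`, `λ` and action by hypothesis.
[cite: MumfordFogartyKirwan1994, Ch. 7 §2 Definition 7.3 (p. 130)] [cite: MumfordFogartyKirwan1994, Ch. 6 §1 Corollary 6.4 (p. 117)] [cite: Kottwitz1992, §5 (p. 390)] -/
theorem tupleRel_id_of_iso_of_hatTransportOver (lam₁ : A₁.X ⟶ D₁.hat.X) (lam₂ : A₂.X ⟶ D₂.hat.X) (φ₁ : A₁.LevelStructure g n)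
    (φ₂ : A₂.LevelStructure g n)
    (hD₁ : Nonempty ((Scheme.Modules.pullback (DualPair.unitHatSlice D₁)).obj D₁.P ≅ SheafOfModules.unit _))
    (hD₂ : Nonempty ((Scheme.Modules.pullback (DualPair.unitHatSlice D₂)).obj D₂.P ≅ SheafOfModules.unit _))
    (hσ : ∀ i, φ₁.σ i ≫ e.hom = φ₂.σ i) (hlam : e.hom ≫ lam₂ = lam₁ ≫ DualPair.hatTransportOver D₂ D₁ e)
    (hact : ∀ a, ρ₁.i a ≫ e.hom = e.hom ≫ ρ₂.i a) :
    φ₁.IsBaseChangeVia φ₂ (𝟙 T) e.hom.left ∧ D₁.hat.IsBaseChangeVia D₂.hat (𝟙 T) (DualPair.hatTransport D₂ D₁ e) ∧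
      (∃ (wG : A₁.X.hom ≫ 𝟙 T = e.hom.left ≫ A₂.X.hom) (wĜ : D₁.hat.X.hom ≫ 𝟙 T = DualPair.hatTransport D₂ D₁ e ≫ D₂.hat.X.hom),
        Nonempty ((Scheme.Modules.pullback
          (pullback.map A₁.X.hom D₁.hat.X.hom A₂.X.hom D₂.hat.X.hom e.hom.left (DualPair.hatTransport D₂ D₁ e) (𝟙 T) wG wĜ)).obj D₂.P ≅ D₁.P)) ∧
      lam₁.left ≫ DualPair.hatTransport D₂ D₁ e = e.hom.left ≫ lam₂.left ∧ ∀ a : O, (ρ₁.i a).left ≫ e.hom.left = e.hom.left ≫ (ρ₂.i a).left := by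
  haveI : IsMonHom e.symm.hom := (inferInstance : IsMonHom e.inv)
  refine ⟨levelStructure_isBaseChangeVia_id_of_isMonHom φ₁ φ₂ e.hom hσ,
    DualPair.hat_isBaseChangeVia_id_hatTransport_of_isLocallyNoetherian_base D₂ D₁ e e.symm rfl hD₂ hD₁,
    ⟨by rw [Category.comp_id, Over.w e.hom], by rw [Category.comp_id, DualPair.hatTransport_comp_hom],
      DualPair.nonempty_pullback_map_hatTransport_iso D₂ D₁ e⟩, ?_, fun a => ?_⟩
  · rw [← DualPair.hatTransportOver_left, ← Over.comp_left, ← Over.comp_left, hlam]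
  · rw [← Over.comp_left, ← Over.comp_left, hact a]

/-! ### §2 Level and polarisation produced by transport, action given with its equivariance -/

/-- **MOVE A TUPLE ALONG A GROUP ISOMORPHISM, KEEPING A PRESCRIBED EQUIVARIANT ACTION ON THE TARGET.**  For `e : A₁ ≅ A₂` a homomorphism of
`T`-group schemes (`T` reduced, locally Noetherian), a POLARISED source `(A₁, ρ₁, (Â₁, 𝒫₁), pol₁, φ₁)`, a target dual pair `D₂` with the unit hypothesis,
and a target action `ρ₂` with `ρ₁(a) ≫ e = e ≫ ρ₂(a)`: there are a level structure `φ₂` (★ `LevelStructure.exists_comp_of_iso`: `φ₂.σᵢ = φ₁.σᵢ ≫ e`) and a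
POLARISATION `pol₂` of `(A₂, D₂)` (★ `Polarization.exists_lam_eq_lamTransport`: `pol₂.lam = e⁻¹ ≫ λ₁ ≫ Ĥ_e`) such that the six clauses along `𝟙 T` hold from
tuple 1 to `(A₂, ρ₂, D₂, pol₂, φ₂)` via `(e, Ĥ_e)` (§1).  The shape of a MOVE TO A FINER STAGE in the `stub_GSPREAD` chain: `e := (facObjIso (relLeg σ) 𝒜ₜ.X)⁻¹`
(iterated ≅ single base change, ★), `ρ₂ :=` the base change of the action spread by ★ (s1-ι), whose output `hz` IS the equivariance.
[cite: MumfordFogartyKirwan1994, Ch. 7 §2 Definition 7.2 (p. 129) and Definition 7.3 (p. 130)] [cite: Kottwitz1992, §5 (p. 390)] [cite: MilneAV2008, I §8 pp. 36–37] -/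
theorem exists_levelStructure_polarization_tupleRel_id_of_iso (pol₁ : A₁.Polarization D₁) (φ₁ : A₁.LevelStructure g n)
    (hD₂ : Nonempty ((Scheme.Modules.pullback (DualPair.unitHatSlice D₂)).obj D₂.P ≅ SheafOfModules.unit _))
    (hact : ∀ a, ρ₁.i a ≫ e.hom = e.hom ≫ ρ₂.i a) :
    ∃ (φ₂ : A₂.LevelStructure g n) (pol₂ : A₂.Polarization D₂),
      (∀ i, φ₂.σ i = φ₁.σ i ≫ e.hom) ∧ pol₂.lam = DualPair.lamTransport D₁ D₂ e.symm e pol₁.lam ∧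
      (φ₁.IsBaseChangeVia φ₂ (𝟙 T) e.hom.left ∧ D₁.hat.IsBaseChangeVia D₂.hat (𝟙 T) (DualPair.hatTransport D₂ D₁ e) ∧
        (∃ (wG : A₁.X.hom ≫ 𝟙 T = e.hom.left ≫ A₂.X.hom) (wĜ : D₁.hat.X.hom ≫ 𝟙 T = DualPair.hatTransport D₂ D₁ e ≫ D₂.hat.X.hom),
          Nonempty ((Scheme.Modules.pullback
            (pullback.map A₁.X.hom D₁.hat.X.hom A₂.X.hom D₂.hat.X.hom e.hom.left (DualPair.hatTransport D₂ D₁ e) (𝟙 T) wG wĜ)).obj D₂.P ≅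
              D₁.P)) ∧
        pol₁.lam.left ≫ DualPair.hatTransport D₂ D₁ e = e.hom.left ≫ pol₂.lam.left ∧
        ∀ a : O, (ρ₁.i a).left ≫ e.hom.left = e.hom.left ≫ (ρ₂.i a).left) := by
  haveI : IsMonHom e.symm.hom := (inferInstance : IsMonHom e.inv)
  obtain ⟨φ₂, hφ⟩ := LevelStructure.exists_comp_of_iso e φ₁
  obtain ⟨pol₂, hpol⟩ := Polarization.exists_lam_eq_lamTransport D₁ D₂ e.symm e rfl pol₁.nonempty_unitHatSlice_iso hD₂ pol₁
  have hlam : e.hom ≫ pol₂.lam = pol₁.lam ≫ DualPair.hatTransportOver D₂ D₁ e := by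
    rw [hpol, DualPair.lamTransport, Iso.symm_hom, Iso.hom_inv_id_assoc]
  exact ⟨φ₂, pol₂, hφ, hpol, tupleRel_id_of_iso_of_hatTransportOver D₁ D₂ ρ₁ ρ₂ e pol₁.lam pol₂.lam φ₁ φ₂
    pol₁.nonempty_unitHatSlice_iso hD₂ (fun i => (hφ i).symm) hlam hact⟩

end AbelianSchemeOver

end Literature.AlgebraicGeometry.AbelianSchemes

end
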